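import Mathlib
import Literature.Analysis.FluidPDE.StationaryEulerWavePackets
import Literature.Analysis.FluidPDE.StationaryEulerAlignedCubes
import Summits.AnomalousDissipation.AnomalousDissipation.Theorems.PointSinkPointFluxConeBoxIterationTools
import HarnessLib

/-!
# `PointFluxCone`, line `Sketch` — finite-stage weak identities in the box (integration by parts)

Helper file of the lead prover for item stmt-AnomalousDissipation-19033 (route PointSink, crux
`PointFluxCone`), line `Sketch`, stub `stub_wildBox`, for the limit lemma `stub_wildBoxLimitTools`:
a smooth state field `w` (and pressure `π`) vanishing off the unit box of `ℝ³` whose velocity is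
classically divergence free and whose stress satisfies `div (u + π I) = 0` classically satisfies
the WEAK identities `∫ ⟪v, ∇θ⟫ = 0` and `∫ Σᵢⱼ (uᵢⱼ + π δᵢⱼ) ∂ⱼΦᵢ = 0` for all smooth tests
(no support condition on the tests: the fields themselves are compactly supported), by the Leibniz
rule and `∫ ∂_v (compactly supported C¹) = 0` (`StationaryEuler.WaveCert.integral_pd_eq_zero`).
-/

noncomputable section

open scoped InnerProductSpace ContDiff ENNReal Topology
open Set Function MeasureTheory Metric Filter
open Literature.Analysis.FluidPDE Literature.Analysis.FluidPDE.StationaryEuler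
open Literature.Analysis.FunctionSpaces

set_option linter.dupNamespace false

namespace Summit.AnomalousDissipation.AnomalousDissipation.Theorems

/-- Coordinates of a smooth state field are smooth. [folklore] -/
theorem wildBoxIBP_contDiff_coord {w : Ed (Fin 3) → State (Fin 3)} (hw : ContDiff ℝ ∞ w) (c : Idx (Fin 3)) :
    ContDiff ℝ ∞ fun y => w y c :=
  (EuclideanSpace.proj (𝕜 := ℝ) c).contDiff.comp hw

/-- A function on `ℝ³` vanishing off the unit box has compact support. [folklore] -/
theorem wildBoxIBP_hasCompactSupport {F : Type*} [Zero F] [TopologicalSpace F] {f : Ed (Fin 3) → F}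
    (h0 : ∀ x, x ∉ box (Fin 3) → f x = 0) : HasCompactSupport f :=
  HasCompactSupport.intro (isCompact_closedBall _ _) fun x hx =>
    h0 x fun hb => hx (boxIter_box_subset_closedBall hb)

/-- **Integration by parts against a smooth compactly supported coefficient**:
`∫ f ∂_v g = -∫ (∂_v f) g` for `f` smooth with compact support and `g` smooth. [folklore] -/
theorem wildBoxIBP_integral_mul_pd {f g : Ed (Fin 3) → ℝ} (hf : ContDiff ℝ ∞ f) (hfc : HasCompactSupport f)
    (hg : ContDiff ℝ ∞ g) (v : Ed (Fin 3)) :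
    ∫ x, f x * pd v g x = -∫ x, pd v f x * g x := by
  have hfd : Differentiable ℝ f := hf.differentiable (by simp)
  have hgd : Differentiable ℝ g := hg.differentiable (by simp)
  have hprod : ContDiff ℝ 1 fun x => f x * g x := (hf.mul hg).of_le (by simp)
  have h0 := WaveCert.integral_pd_eq_zero hprod hfc.mul_right v
  rw [pd_mul hfd hgd] at h0
  have h1 : Integrable fun x => pd v f x * g x :=
    ((continuous_pd (hf.of_le (by simp)) v).mul hg.continuous).integrable_of_hasCompactSupport
      ((hasCompactSupport_pd hfc v).mul_right)
  have h2 : Integrable fun x => f x * pd v g x :=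
    (hf.continuous.mul (continuous_pd (hg.of_le (by simp)) v)).integrable_of_hasCompactSupport hfc.mul_right
  rw [integral_add h1 h2] at h0
  linarith

/-- **Weak `div v = 0` at a finite stage**: a smooth state field vanishing off the box with
classically divergence-free velocity satisfies `∫ ⟪v, ∇θ⟫ = 0` for every smooth `θ`.
[cite: ChoffrutSzekelyhidi2014, Lemma 2] -/
theorem wildBoxIBP_vel {w : Ed (Fin 3) → State (Fin 3)} (hw : ContDiff ℝ ∞ w)
    (hw0 : ∀ x, x ∉ box (Fin 3) → w x = 0)
    (hdiv : ∀ x, ∑ i, pd (eb i) (fun y => vel (w y) i) x = 0)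
    {θ : Ed (Fin 3) → ℝ} (hθ : ContDiff ℝ ∞ θ) :
    ∫ x, ⟪vel (w x), gradient θ x⟫_ℝ = 0 := by
  -- the integrand in coordinates
  have hcoord : ∀ x, ⟪vel (w x), gradient θ x⟫_ℝ = ∑ i, vel (w x) i * pd (eb i) θ x := by
    intro x
    rw [real_inner_comm, gradient, InnerProductSpace.toDual_symm_apply]
    have hv : vel (w x) = ∑ i, vel (w x) i • eb i := by
      have := (EuclideanSpace.basisFun (Fin 3) ℝ).sum_repr (vel (w x))
      simp only [EuclideanSpace.basisFun_repr, EuclideanSpace.basisFun_apply] at this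
      exact this.symm
    conv_lhs => rw [hv]
    simp only [map_sum, map_smul, smul_eq_mul, pd]
  simp_rw [hcoord]
  have hfi : ∀ i, ContDiff ℝ ∞ fun y => vel (w y) i := fun i => by
    simp only [vel_apply]; exact wildBoxIBP_contDiff_coord hw _
  have hfc : ∀ i, HasCompactSupport fun y => vel (w y) i := fun i =>
    wildBoxIBP_hasCompactSupport fun x hx => by simp [hw0 x hx]
  have hint : ∀ i, Integrable fun x => vel (w x) i * pd (eb i) θ x := fun i =>
    ((hfi i).continuous.mul (continuous_pd (hθ.of_le (by simp)) _)).integrable_of_hasCompactSupport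
      (hfc i).mul_right
  rw [integral_finsetSum _ fun i _ => hint i]
  have hibp : ∀ i, ∫ x, vel (w x) i * pd (eb i) θ x = -∫ x, pd (eb i) (fun y => vel (w y) i) x * θ x :=
    fun i => wildBoxIBP_integral_mul_pd (hfi i) (hfc i) hθ (eb i)
  simp_rw [hibp]
  have hint' : ∀ i, Integrable fun x => pd (eb i) (fun y => vel (w y) i) x * θ x := fun i =>
    ((continuous_pd ((hfi i).of_le (by simp)) _).mul hθ.continuous).integrable_of_hasCompactSupport
      ((hasCompactSupport_pd (hfc i) _).mul_right)
  rw [Finset.sum_neg_distrib, ← integral_finsetSum _ fun i _ => hint' i, neg_eq_zero]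
  have hfun : (fun x => ∑ i, pd (eb i) (fun y => vel (w y) i) x * θ x) = fun _ => 0 := by
    funext x; rw [← Finset.sum_mul, hdiv x, zero_mul]
  rw [hfun, integral_zero]

/-- **Weak `div (u + π I) = 0` at a finite stage**: a smooth state field and pressure vanishing
off the box with `Σⱼ ∂ⱼ(uᵢⱼ + π δᵢⱼ) = 0` classically satisfy
`∫ Σᵢⱼ (uᵢⱼ + π δᵢⱼ) ∂ⱼΦᵢ = 0` for every smooth vector test `Φ`. [cite: ChoffrutSzekelyhidi2014, Lemma 2] -/
theorem wildBoxIBP_str {w : Ed (Fin 3) → State (Fin 3)} (hw : ContDiff ℝ ∞ w) {π : Ed (Fin 3) → ℝ}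
    (hπ : ContDiff ℝ ∞ π) (hw0 : ∀ x, x ∉ box (Fin 3) → w x = 0) (hπ0 : ∀ x, x ∉ box (Fin 3) → π x = 0)
    (hdiv : ∀ x i, ∑ j, pd (eb j) (fun y => str (w y) i j + (if i = j then π y else 0)) x = 0)
    {Φ : Ed (Fin 3) → Ed (Fin 3)} (hΦ : ContDiff ℝ ∞ Φ) :
    ∫ x, ∑ i, ∑ j, (str (w x) i j + (if i = j then π x else 0)) * pd (eb j) (fun y => Φ y i) x = 0 := by
  have hFij : ∀ i j, ContDiff ℝ ∞ fun y => str (w y) i j + (if i = j then π y else 0) := by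
    intro i j
    have h1 : ContDiff ℝ ∞ fun y => str (w y) i j := by
      simp only [str_apply]; exact wildBoxIBP_contDiff_coord hw _
    split_ifs
    · exact h1.add hπ
    · simpa using h1
  have hFc : ∀ i j, HasCompactSupport fun y => str (w y) i j + (if i = j then π y else 0) := fun i j =>
    wildBoxIBP_hasCompactSupport fun x hx => by simp [hw0 x hx, hπ0 x hx]
  have hΦi : ∀ i, ContDiff ℝ ∞ fun y => Φ y i := fun i => (EuclideanSpace.proj (𝕜 := ℝ) i).contDiff.comp hΦ
  have hint : ∀ i j, Integrable fun x =>
      (str (w x) i j + (if i = j then π x else 0)) * pd (eb j) (fun y => Φ y i) x := fun i j =>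
    ((hFij i j).continuous.mul (continuous_pd ((hΦi i).of_le (by simp)) _)).integrable_of_hasCompactSupport
      (hFc i j).mul_right
  have hint' : ∀ i j, Integrable fun x =>
      pd (eb j) (fun y => str (w y) i j + (if i = j then π y else 0)) x * Φ x i := fun i j =>
    ((continuous_pd ((hFij i j).of_le (by simp)) _).mul (hΦi i).continuous).integrable_of_hasCompactSupport
      ((hasCompactSupport_pd (hFc i j) _).mul_right)
  rw [integral_finsetSum _ fun i _ => integrable_finsetSum _ fun j _ => hint i j]
  refine Finset.sum_eq_zero fun i _ => ?_
  rw [integral_finsetSum _ fun j _ => hint i j]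
  have hibp : ∀ j, ∫ x, (str (w x) i j + (if i = j then π x else 0)) * pd (eb j) (fun y => Φ y i) x =
      -∫ x, pd (eb j) (fun y => str (w y) i j + (if i = j then π y else 0)) x * Φ x i :=
    fun j => wildBoxIBP_integral_mul_pd (hFij i j) (hFc i j) (hΦi i) (eb j)
  simp_rw [hibp]
  rw [Finset.sum_neg_distrib, ← integral_finsetSum _ fun j _ => hint' i j, neg_eq_zero]
  have hfun : (fun x => ∑ j, pd (eb j) (fun y => str (w y) i j + (if i = j then π y else 0)) x * Φ x i) =
      fun _ => 0 := by
    funext x; rw [← Finset.sum_mul, hdiv x i, zero_mul]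
  rw [hfun, integral_zero]

/-- Registered tools sub-stub `stub_wildBoxLimitIBPTools`: the two finite-stage weak identities
(`wildBoxIBP_vel`, `wildBoxIBP_str`). [cite: ChoffrutSzekelyhidi2014, Lemma 2] -/
theorem stub_wildBoxLimitIBPTools :
    ((∀ (w : Ed (Fin 3) → State (Fin 3)), ContDiff ℝ ∞ w → (∀ x, x ∉ box (Fin 3) → w x = 0) → (∀ x, ∑ i, pd (eb i) (fun y => vel (w y) i) x = 0) → ∀ (θ : Ed (Fin 3) → ℝ), ContDiff ℝ ∞ θ → ∫ x, ⟪vel (w x), gradient θ x⟫_ℝ = 0) ∧ (∀ (w : Ed (Fin 3) → State (Fin 3)) (π : Ed (Fin 3) → ℝ), ContDiff ℝ ∞ w → ContDiff ℝ ∞ π → (∀ x, x ∉ box (Fin 3) → w x = 0) → (∀ x, x ∉ box (Fin 3) → π x = 0) → (∀ x i, ∑ j, pd (eb j) (fun y => str (w y) i j + (if i = j then π y else 0)) x = 0) → ∀ (Φ : Ed (Fin 3) → Ed (Fin 3)), ContDiff ℝ ∞ Φ → ∫ x, ∑ i, ∑ j, (str (w x) i j + (if i = j then π x else 0)) * pd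 (eb j) (fun y => Φ y i) x = 0)) :=
  ⟨fun _ hw hw0 hdiv _ hθ => wildBoxIBP_vel hw hw0 hdiv hθ,
    fun _ _ hw hπ hw0 hπ0 hdiv _ hΦ => wildBoxIBP_str hw hπ hw0 hπ0 hdiv hΦ⟩

end Summit.AnomalousDissipation.AnomalousDissipation.Theorems

end
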